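import Summits.ABC.ABC.Theorems.RibetTakahashiSplitWeightedSzpiroBoundAbc
import Summits.ABC.ABC.Theorems.RibetTakahashiSplitValuationProductOfCurvesModels
import Summits.ABC.ABC.Theorems.RibetTakahashiSplitSubexpOfValuationProduct
import Literature.NumberTheory.EllipticCurves.SzpiroFreyCurveProofs

/-!
# Route RibetTakahashiSplit — the consumers of the crux `ManyPrimeValuationProduct` need it only on
# the Frey–Hellegouarch class

Consumer analysis for the crux r2 =
`Summit.ABC.ABC.Theses.RibetTakahashiSplit.ManyPrimeValuationProduct` (item stmt-ABC-1561;
`--supports`, line `jl-zero-cycle-height`, stub `stub_fermatInputResidual`).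
The crux ranges over ALL elliptic `W/ℚ` semistable away from `2` with `≥ 4` odd multiplicative
primes. Its consumers in the route are

* the `Assembly` `ManyPrimeValuationProduct → FewPrimeValuationProduct → WeightedSzpiroBound → ABC`
  (item stmt-ABC-11012), through which the deciding theorem `RibetTakahashiSplit.closes` runs;
* glue A `SubexpManyPrimesOfValuationProduct` (stmt-ABC-1570): r2 → the milestone
  `SubexpABCManyPrimes` (stmt-ABC-1568);
* glue B `ValuationProductOfCurves` (stmt-ABC-1571): r2 → r4 → the milestone
  `AbcValuationProduct` (stmt-ABC-1567).

Maintenance record (full-build repair, 2026-08-16). The gate's LINT AUTOFIX of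
2026-08-16T14:16:23Z (items-cap) dropped the two milestone decls `SubexpABCManyPrimes`
(stmt-ABC-1568) and `AbcValuationProduct` (stmt-ABC-1567) from the gate-written
`Summits/ABC/ABC/Theses/RibetTakahashiSplit.lean`, after which glue A and glue B below (whose
conclusions were those decl names) no longer elaborated ("Unknown identifier", full build of
2026-08-16T19:45Z). Their conclusions are therefore written out VERBATIM (the dropped decls' bodies)
under the new names `subexpManyPrimes_of_manyPrimeFreyClass` and
`exponentProductBound_of_manyPrimeFreyClass` — same propositions, same proofs — and the old
names survive as deprecated aliases.

This file proves, kernel-checked and def-free, that each consumer needs r2 only RESTRICTED TO THE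
FREY–HELLEGOUARCH CLASS — curves `W` with `C' • W = freyCurve (d a) (d b)` for some change of
variables `C'`, coprime `a, b` with `ab(a+b) ≠ 0`, and `d ∣ 2` (the skeleton's `IsFreyIsomorphic W`,
written out) — i.e. exactly the sub-class on which the line's Fermat input is KNOWN
(`stub_fermatInputKnown`: Pasten L.6.12, Wiles–Ribet–Darmon–Merel), so that the OPEN residual stub
`stub_fermatInputResidual` (curves additive at `2` with no Frey model) is not load-bearing for
anything the route consumes:

* `abc_of_manyPrimeFreyClass` — the Assembly chain with r2 replaced by its Frey-class restriction
  (in fact r2 and r4 are not used at all: r3′ alone gives `ABC`, `WeightedSzpiroBound.abc_of`);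
* `subexpManyPrimes_of_manyPrimeFreyClass` — glue A from the Frey-class restriction (formerly
  `subexpABCManyPrimes_of_manyPrimeFreyClass`);
* `exponentProductBound_of_manyPrimeFreyClass` — glue B from the Frey-class restriction and r4
  (formerly `abcValuationProduct_of_manyPrimeFreyClass`).

The one geometric input is `FreyClassSuffices.exists_freyCurve_model`: the curve the glues attach
to an abc triple (Bombieri–Gubler Ex. 12.5.10: the model (12.18) `freyIntModel₂ A B` of Serre's
arrangement if `16 ∣ abc`, else (12.17) `freyIntModel a b`) is `freyCurve A B` up to the change of
variables `x = 4x'`, `y = 8y' + 4x'` (`smul_freyCurve_eq_baseChange_freyIntModel₂`), resp. on the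
nose (`baseChange_freyIntModel`) — so it lies in the Frey class with `d = 1`.

Consequence for the planner: re-cutting r2 to the class "semistable away from `2` AND (semistable
or Frey-isomorphic)" — or even to the Frey class alone — keeps the deciding theorem `closes`, glue A
and glue B intact (the three theorems below; the restricted hypothesis is a weakening of r2 — drop
the extra hypothesis — so they also recover the glues as filed), while on that class the line's
`fermatInputOnClass_of` needs `stub_fermatInputKnown` only.
-/

-- `Summit.<Summit>.<Problem>` is the mandated summit-side namespace (CONVENTIONS §2); for the
-- single-conjunct summit `ABC` the two coincide, so the duplicate `ABC.ABC` is deliberate.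
set_option linter.dupNamespace false

noncomputable section

namespace Summit.ABC.ABC.Theorems

open IsDedekindDomain WeierstrassCurve UniqueFactorizationMonoid Rat.HeightOneSpectrum
open Literature.NumberTheory.EllipticCurves Literature.NumberTheory.DiophantineGeometry
open Summit.ABC.ABC.Theses.RibetTakahashiSplit

/-! ## The Frey curve of an abc triple lies in the Frey class -/

-- adapted from Summits/ABC/ABC/Theorems/RibetTakahashiSplitValuationProductOfCurves.lean
-- (`ValuationProductOfCurves.exists_curve`) and
-- Literature/NumberTheory/EllipticCurves/SzpiroFreyProofs.lean (`exists_minimal_frey_model`):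
-- same case split, with the Frey witness recorded.
/-- **Frey translation with witness** (Bombieri–Gubler, Ex. 12.5.10). Every abc triple `(a, b, c)`
carries an elliptic curve `W/ℚ` which is semistable away from `2`, is `ℚ`-isomorphic to a
Frey–Hellegouarch curve `freyCurve (d A) (d B)` (`A, B` coprime, `AB(A+B) ≠ 0`, `d ∣ 2`; here
`d = 1` and `|AB(A+B)| = abc`), has `N_W ∣ 2¹⁰ rad(abc)`, has every odd prime of `abc` among its
odd multiplicative primes, and satisfies `∏_{p ∣ abc} v_p(abc) ≤ 4 · T(W)`,
`T(W) = ∏_{p ∥ N_W} v_p(Δ_min(W))`: namely `freyIntModel₂ A B ⊗ ℚ` for Serre's arrangement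
`(A, B)` if `16 ∣ abc` (isomorphic to `freyCurve A B` by `x = 4x'`, `y = 8y' + 4x'`), and
`freyIntModel a b ⊗ ℚ = freyCurve a b` otherwise. [cite: BombieriGubler2006, Ex. 12.5.10] -/
theorem FreyClassSuffices.exists_freyCurve_model {a b c : ℕ} (h : IsABCTriple a b c) :
    ∃ W : WeierstrassCurve ℚ, W.IsElliptic ∧
      (∀ p : ℕ, p.Prime → p ≠ 2 → ¬ p ^ 2 ∣ W.conductorNorm ℤ) ∧
      (∃ (A B d : ℤ) (C' : VariableChange ℚ), IsCoprime A B ∧ A * B * (A + B) ≠ 0 ∧ d ∣ 2 ∧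
        C' • W = freyCurve (d * A) (d * B)) ∧
      W.conductorNorm ℤ ∣ 2 ^ 10 * rad a b c ∧
      (a * b * c).primeFactors.erase 2 ⊆
        (W.conductorNorm ℤ).primeFactors.filter (fun p => p ≠ 2 ∧ ¬ p ^ 2 ∣ W.conductorNorm ℤ) ∧
      ∏ p ∈ (a * b * c).primeFactors, (a * b * c).factorization p ≤
        4 * multiplicativeValuationProduct W := by
  have h' := h
  obtain ⟨ha, hb, habc, hcop⟩ := h'
  have hc : 0 < c := by omega
  have habc0 : a * b * c ≠ 0 := by positivity
  -- the membership statement, from "odd primes of `abc` divide `N`" and semistability away from `2`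
  have hmem : ∀ (W : WeierstrassCurve ℚ) [W.IsElliptic],
      (∀ p : ℕ, p.Prime → p ≠ 2 → ¬ p ^ 2 ∣ W.conductorNorm ℤ) →
      (∀ p ∈ (a * b * c).primeFactors, p ≠ 2 → p ∣ W.conductorNorm ℤ) →
      (a * b * c).primeFactors.erase 2 ⊆ (W.conductorNorm ℤ).primeFactors.filter
        (fun p => p ≠ 2 ∧ ¬ p ^ 2 ∣ W.conductorNorm ℤ) := by
    intro W _ hss hdvd p hp
    rw [Finset.mem_erase] at hp
    have hpp : p.Prime := Nat.prime_of_mem_primeFactors hp.2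
    rw [Finset.mem_filter, Nat.mem_primeFactors]
    exact ⟨⟨hpp, hdvd p hp.2 hp.1, (conductorNorm_pos_holds W).ne'⟩, hp.1, hss p hpp hp.1⟩
  by_cases h16 : 16 ∣ a * b * c
  · -- (12.18) for Serre's arrangement `A ≡ -1 (mod 4)`, `16 ∣ B`
    obtain ⟨A, B, hAB, hA, hB, hprod, -⟩ := exists_arrangement h h16
    have h0 : A * B * (A + B) ≠ 0 := by
      rw [← Int.natAbs_ne_zero, hprod]; exact habc0
    have h4 : 4 ∣ B - A - 1 := by
      have : B - A - 1 = B - (A + 1) := by ring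
      rw [this]; exact dvd_sub (dvd_trans (by norm_num) hB) hA
    have h16' : 16 ∣ A * B := dvd_mul_of_dvd_right hB _
    obtain ⟨hE, hss, hdvd, hN, hle⟩ := ValuationProductOfCurves.freyIntModel₂_package hAB h0 hA hB
    rw [hprod] at hdvd hle hN
    haveI := hE
    refine ⟨(freyIntModel₂ A B).baseChange ℚ, hE, fun p hp _ => hss p hp, ?_, ?_,
      hmem _ (fun p hp _ => hss p hp) hdvd, hle⟩
    · refine ⟨A, B, 1, (⟨Units.mk0 (2 : ℚ) two_ne_zero, 0, 1, 0⟩ : VariableChange ℚ)⁻¹, hAB, h0,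
        one_dvd _, ?_⟩
      rw [one_mul, one_mul, ← smul_freyCurve_eq_baseChange_freyIntModel₂ h4 h16', inv_smul_smul]
    · rw [rad_def]
      exact hN.trans (dvd_mul_left _ _)
  · -- (12.17) with `(A, B) = (a, b)`
    have hab : IsCoprime (a : ℤ) (b : ℤ) := Nat.isCoprime_iff_coprime.mpr hcop
    have hP : (a : ℤ) * b * (a + b) = ((a * b * c : ℕ) : ℤ) := by rw [← habc]; push_cast; ring
    have h0 : (a : ℤ) * b * (a + b) ≠ 0 := by rw [hP]; exact_mod_cast habc0
    have h16' : ¬ (16 : ℤ) ∣ (a : ℤ) * b * (a + b) := by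
      rw [hP]; exact_mod_cast mt Int.natCast_dvd_natCast.mp h16
    obtain ⟨hE, hss, hdvd, hN, hle⟩ := ValuationProductOfCurves.freyIntModel_package hab h0 h16'
    rw [hP, Int.natAbs_natCast] at hdvd hN hle
    haveI := hE
    refine ⟨(freyIntModel (a : ℤ) b).baseChange ℚ, hE, hss, ?_, by rwa [rad_def], hmem _ hss hdvd,
      hle⟩
    refine ⟨a, b, 1, 1, hab, h0, one_dvd _, ?_⟩
    rw [one_smul, one_mul, one_mul, baseChange_freyIntModel]

/-! ## The Assembly consumer -/

/-- **The route's deciding chain needs r2 only on the Frey class** (in fact not at all).  The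
`Assembly` `ManyPrimeValuationProduct → FewPrimeValuationProduct → WeightedSzpiroBound → ABC`
(item stmt-ABC-11012, through which `RibetTakahashiSplit.closes` runs) remains true when the
crux r2 is replaced by its restriction to curves `ℚ`-isomorphic to a Frey–Hellegouarch curve
`freyCurve (d a) (d b)` (`a, b` coprime, `ab(a+b) ≠ 0`, `d ∣ 2`): the weighted Szpiro crux r3′
alone implies `ABC` (`WeightedSzpiroBound.abc_of`), so neither valuation-product crux is consumed
here. [folklore] -/
theorem abc_of_manyPrimeFreyClass :
    (∀ ε : ℝ, 0 < ε → ∃ C : ℝ, ∀ (W : WeierstrassCurve ℚ) [W.IsElliptic],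
      (∀ p : ℕ, p.Prime → p ≠ 2 → ¬ p ^ 2 ∣ W.conductorNorm ℤ) →
      (∃ (a b d : ℤ) (C' : WeierstrassCurve.VariableChange ℚ), IsCoprime a b ∧
        a * b * (a + b) ≠ 0 ∧ d ∣ 2 ∧
        C' • W = Literature.NumberTheory.EllipticCurves.freyCurve (d * a) (d * b)) →
      4 ≤ ((W.conductorNorm ℤ).primeFactors.filter
        (fun p => p ≠ 2 ∧ ¬ p ^ 2 ∣ W.conductorNorm ℤ)).card →
      ((∏ p ∈ (W.conductorNorm ℤ).primeFactors with ¬ p ^ 2 ∣ W.conductorNorm ℤ,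
        (W.minimalDiscriminantNorm ℤ).factorization p : ℕ) : ℝ) ≤
          C * (W.conductorNorm ℤ : ℝ) ^ ε) →
    Summit.ABC.ABC.Theses.RibetTakahashiSplit.FewPrimeValuationProduct →
    Summit.ABC.ABC.Theses.RibetTakahashiSplit.WeightedSzpiroBound → ABC :=
  fun _ _ hW => WeightedSzpiroBound.abc_of hW

/-! ## Glue A on the Frey class: the milestone `SubexpABCManyPrimes` -/

-- adapted from Summits/ABC/ABC/Theorems/RibetTakahashiSplitSubexpABCManyPrimes.lean
-- (`subexpABCManyPrimes_of_manyPrimeValuationProduct`) and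
-- Summits/ABC/ABC/Theorems/RibetTakahashiSplitSubexpOfValuationProduct.lean (glue C).
/-- **Glue A needs r2 only on the Frey class.** The restriction of `ManyPrimeValuationProduct` to
curves `ℚ`-isomorphic to a Frey–Hellegouarch curve `freyCurve (d a) (d b)` (`a, b` coprime,
`ab(a+b) ≠ 0`, `d ∣ 2`) already implies the milestone `SubexpABCManyPrimes` (stmt-ABC-1568): for
an abc triple with `ω(abc) ≥ 5` the curve `W` of `FreyClassSuffices.exists_freyCurve_model` is in
the Frey class, semistable away from `2`, with `≥ 4` odd multiplicative primes, so the restricted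
crux at `δ = ε/2` gives `T(W) ≤ C N^δ ≤ C (2¹⁰ rad)^δ`; and `c ≤ abc ≤ rad(abc)^M` with
`M = ∏_{p ∣ abc} v_p(abc) ≤ 4 T(W)`, so `log c ≤ M log rad ≤ 4 max(C,0) 2^{10δ} rad^δ · rad^δ/δ`.
The conclusion is the statement of the former route milestone `SubexpABCManyPrimes`
(stmt-ABC-1568, dropped from the route's item list 2026-08-16), written out verbatim; this theorem
replaces `subexpABCManyPrimes_of_manyPrimeFreyClass` (same content, whose conclusion was that decl
name). [cite: BombieriGubler2006, Ex. 12.5.10] -/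
theorem subexpManyPrimes_of_manyPrimeFreyClass :
    (∀ ε : ℝ, 0 < ε → ∃ C : ℝ, ∀ (W : WeierstrassCurve ℚ) [W.IsElliptic],
      (∀ p : ℕ, p.Prime → p ≠ 2 → ¬ p ^ 2 ∣ W.conductorNorm ℤ) →
      (∃ (a b d : ℤ) (C' : WeierstrassCurve.VariableChange ℚ), IsCoprime a b ∧
        a * b * (a + b) ≠ 0 ∧ d ∣ 2 ∧
        C' • W = Literature.NumberTheory.EllipticCurves.freyCurve (d * a) (d * b)) →
      4 ≤ ((W.conductorNorm ℤ).primeFactors.filter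
        (fun p => p ≠ 2 ∧ ¬ p ^ 2 ∣ W.conductorNorm ℤ)).card →
      ((∏ p ∈ (W.conductorNorm ℤ).primeFactors with ¬ p ^ 2 ∣ W.conductorNorm ℤ,
        (W.minimalDiscriminantNorm ℤ).factorization p : ℕ) : ℝ) ≤
          C * (W.conductorNorm ℤ : ℝ) ^ ε) →
    ∀ ε : ℝ, 0 < ε → ∃ κ : ℝ, ∀ a b c : ℕ,
      Literature.NumberTheory.DiophantineGeometry.IsABCTriple a b c →
      5 ≤ (a * b * c).primeFactors.card →
      Real.log c ≤
        κ * ((Literature.NumberTheory.DiophantineGeometry.rad a b c : ℕ) : ℝ) ^ ε := by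
  intro hF ε hε
  obtain ⟨C, hC⟩ := hF (ε / 2) (half_pos hε)
  set K : ℝ := 4 * max C 0 * ((2 : ℝ) ^ 10) ^ (ε / 2) with hKdef
  have hK0 : 0 ≤ K := by positivity
  refine ⟨K / (ε / 2), fun a b c habc hω => ?_⟩
  obtain ⟨W, hE, hss, hfrey, hN, hsub, hprod⟩ := FreyClassSuffices.exists_freyCurve_model habc
  haveI := hE
  obtain ⟨ha, hb, hsum, -⟩ := habc
  have hc0 : 0 < c := by omega
  have hn0 : a * b * c ≠ 0 := Nat.mul_ne_zero (Nat.mul_ne_zero ha.ne' hb.ne') hc0.ne'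
  -- `≥ 4` odd multiplicative primes
  have h4 : 4 ≤ ((W.conductorNorm ℤ).primeFactors.filter
      (fun p => p ≠ 2 ∧ ¬ p ^ 2 ∣ W.conductorNorm ℤ)).card :=
    calc 4 ≤ (a * b * c).primeFactors.card - 1 := by omega
      _ ≤ ((a * b * c).primeFactors.erase 2).card := Finset.pred_card_le_card_erase
      _ ≤ _ := Finset.card_le_card hsub
  -- the restricted crux on `W`
  have key : (multiplicativeValuationProduct W : ℝ) ≤ C * (W.conductorNorm ℤ : ℝ) ^ (ε / 2) :=
    hC W hss hfrey h4
  -- `c ≤ abc ≤ rad^M`, `M ≤ 4 T(W)`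
  set n : ℕ := a * b * c with hndef
  set M : ℕ := ∏ p ∈ n.primeFactors, n.factorization p with hMdef
  have hcn : c ≤ n := Nat.le_mul_of_pos_left c (Nat.mul_pos ha hb)
  have hcR : c ≤ rad a b c ^ M := by
    rw [rad_def]; exact hcn.trans (le_radical_pow_prod_factorization hn0)
  set R : ℝ := (rad a b c : ℝ) with hRdef
  have hR1 : (1 : ℝ) ≤ R := by
    rw [hRdef, rad_def]; exact_mod_cast Nat.radical_pos n
  have hR0 : (0 : ℝ) < R := one_pos.trans_le hR1
  have hlogR : 0 ≤ Real.log R := Real.log_nonneg hR1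
  have hNR : (W.conductorNorm ℤ : ℝ) ≤ 2 ^ 10 * R := by
    have := Nat.le_of_dvd (mul_pos (by positivity) (by rw [rad_def]; exact Nat.radical_pos _)) hN
    rw [hRdef]; exact_mod_cast this
  -- `M ≤ K R^{ε/2}`
  have hM : (M : ℝ) ≤ K * R ^ (ε / 2) := by
    calc (M : ℝ) ≤ ((4 * multiplicativeValuationProduct W : ℕ) : ℝ) := by exact_mod_cast hprod
      _ = 4 * (multiplicativeValuationProduct W : ℝ) := by push_cast; ring
      _ ≤ 4 * (C * (W.conductorNorm ℤ : ℝ) ^ (ε / 2)) := by linarith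
      _ ≤ 4 * (max C 0 * (W.conductorNorm ℤ : ℝ) ^ (ε / 2)) := by
          gcongr
          exact le_max_left _ _
      _ ≤ 4 * (max C 0 * ((2 : ℝ) ^ 10 * R) ^ (ε / 2)) := by gcongr
      _ = K * R ^ (ε / 2) := by
          rw [hKdef, Real.mul_rpow (by positivity) hR0.le]; ring
  -- `log c ≤ M log R ≤ K R^{ε/2} · R^{ε/2}/(ε/2)`
  have h1 : Real.log c ≤ (M : ℝ) * Real.log R :=
    calc Real.log c ≤ Real.log (R ^ M) :=
          Real.log_le_log (by exact_mod_cast hc0) (by rw [hRdef]; exact_mod_cast hcR)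
      _ = (M : ℝ) * Real.log R := Real.log_pow R M
  have h2 : Real.log R ≤ R ^ (ε / 2) / (ε / 2) := Real.log_le_rpow_div hR0.le (half_pos hε)
  have hKR : 0 ≤ K * R ^ (ε / 2) := by positivity
  calc Real.log c ≤ (M : ℝ) * Real.log R := h1
    _ ≤ K * R ^ (ε / 2) * Real.log R := mul_le_mul_of_nonneg_right hM hlogR
    _ ≤ K * R ^ (ε / 2) * (R ^ (ε / 2) / (ε / 2)) := mul_le_mul_of_nonneg_left h2 hKR
    _ = K / (ε / 2) * (R ^ (ε / 2) * R ^ (ε / 2)) := by ring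
    _ = K / (ε / 2) * R ^ ε := by rw [← Real.rpow_add hR0, add_halves]

/-- Deprecated name of `subexpManyPrimes_of_manyPrimeFreyClass` (it was stated against the route
decl `Summit.ABC.ABC.Theses.RibetTakahashiSplit.SubexpABCManyPrimes`, dropped from the route file
2026-08-16; it remains in the ledger's `supports` record of stmt-ABC-1561 / stmt-ABC-1568, p88416).
[folklore] -/
@[deprecated subexpManyPrimes_of_manyPrimeFreyClass (since := "2026-08-16")]
alias subexpABCManyPrimes_of_manyPrimeFreyClass := subexpManyPrimes_of_manyPrimeFreyClass

/-! ## Glue B on the Frey class: the milestone `AbcValuationProduct` -/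

-- adapted from Summits/ABC/ABC/Theorems/RibetTakahashiSplitValuationProductOfCurves.lean
-- (`valuationProductOfCurves_proof`).
/-- **Glue B needs r2 only on the Frey class.** The restriction of `ManyPrimeValuationProduct` to
curves `ℚ`-isomorphic to a Frey–Hellegouarch curve `freyCurve (d a) (d b)` (`a, b` coprime,
`ab(a+b) ≠ 0`, `d ∣ 2`), together with the few-prime crux `FewPrimeValuationProduct` (r4), already
implies the milestone `AbcValuationProduct` (stmt-ABC-1567): the curve `W` of
`FreyClassSuffices.exists_freyCurve_model` is in the Frey class and semistable away from `2`, so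
the restricted r2 (if `W` has `≥ 4` odd multiplicative primes) or r4 (if `≤ 3`) gives
`T(W) ≤ C N^ε ≤ C (2¹⁰ rad)^ε`, and `∏_{p ∣ abc} v_p(abc) ≤ 4 T(W)`. The conclusion is the
statement of the former route milestone `AbcValuationProduct` (stmt-ABC-1567, dropped from the
route's item list 2026-08-16), written out verbatim; this theorem replaces
`abcValuationProduct_of_manyPrimeFreyClass` (same content, whose conclusion was that decl name).
[cite: BombieriGubler2006, Ex. 12.5.10] -/
theorem exponentProductBound_of_manyPrimeFreyClass :
    (∀ ε : ℝ, 0 < ε → ∃ C : ℝ, ∀ (W : WeierstrassCurve ℚ) [W.IsElliptic],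
      (∀ p : ℕ, p.Prime → p ≠ 2 → ¬ p ^ 2 ∣ W.conductorNorm ℤ) →
      (∃ (a b d : ℤ) (C' : WeierstrassCurve.VariableChange ℚ), IsCoprime a b ∧
        a * b * (a + b) ≠ 0 ∧ d ∣ 2 ∧
        C' • W = Literature.NumberTheory.EllipticCurves.freyCurve (d * a) (d * b)) →
      4 ≤ ((W.conductorNorm ℤ).primeFactors.filter
        (fun p => p ≠ 2 ∧ ¬ p ^ 2 ∣ W.conductorNorm ℤ)).card →
      ((∏ p ∈ (W.conductorNorm ℤ).primeFactors with ¬ p ^ 2 ∣ W.conductorNorm ℤ,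
        (W.minimalDiscriminantNorm ℤ).factorization p : ℕ) : ℝ) ≤
          C * (W.conductorNorm ℤ : ℝ) ^ ε) →
    Summit.ABC.ABC.Theses.RibetTakahashiSplit.FewPrimeValuationProduct →
    ∀ ε : ℝ, 0 < ε → ∃ K : ℝ, ∀ a b c : ℕ,
      Literature.NumberTheory.DiophantineGeometry.IsABCTriple a b c →
      ((∏ p ∈ (a * b * c).primeFactors, (a * b * c).factorization p : ℕ) : ℝ) ≤
        K * ((Literature.NumberTheory.DiophantineGeometry.rad a b c : ℕ) : ℝ) ^ ε := by
  intro hF hR4 ε hε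
  obtain ⟨C₂, hC₂⟩ := hF ε hε
  obtain ⟨C₄, hC₄⟩ := hR4 ε hε
  set C : ℝ := max (max C₂ C₄) 0 with hCdef
  have hC0 : 0 ≤ C := le_max_right _ _
  refine ⟨4 * C * ((2 : ℝ) ^ 10) ^ ε, fun a b c h => ?_⟩
  obtain ⟨W, hE, hss, hfrey, hN, -, hprod⟩ := FreyClassSuffices.exists_freyCurve_model h
  haveI := hE
  -- the restricted r2 (the curve is in the Frey class) or r4, by the number of odd
  -- multiplicative primes
  have hT : (multiplicativeValuationProduct W : ℝ) ≤ C * (W.conductorNorm ℤ : ℝ) ^ ε := by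
    have hNε : 0 ≤ (W.conductorNorm ℤ : ℝ) ^ ε := by positivity
    rcases le_or_gt 4 ((W.conductorNorm ℤ).primeFactors.filter
        (fun p => p ≠ 2 ∧ ¬ p ^ 2 ∣ W.conductorNorm ℤ)).card with h4 | h3
    · exact (hC₂ W hss hfrey h4).trans (mul_le_mul_of_nonneg_right
        ((le_max_left _ _).trans (le_max_left _ _)) hNε)
    · exact (hC₄ W hss (by omega)).trans (mul_le_mul_of_nonneg_right
        ((le_max_right _ _).trans (le_max_left _ _)) hNε)
  set N : ℝ := ((W.conductorNorm ℤ : ℕ) : ℝ) with hNdef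
  set R : ℝ := ((rad a b c : ℕ) : ℝ) with hRdef
  have hR0 : 0 < R := by
    rw [hRdef, rad_def]; exact_mod_cast Nat.radical_pos _
  have hNR : N ≤ 2 ^ 10 * R := by
    have := Nat.le_of_dvd (mul_pos (by positivity) (by rw [rad_def]; exact Nat.radical_pos _)) hN
    rw [hNdef, hRdef]; exact_mod_cast this
  calc ((∏ p ∈ (a * b * c).primeFactors, (a * b * c).factorization p : ℕ) : ℝ)
      ≤ ((4 * multiplicativeValuationProduct W : ℕ) : ℝ) := by exact_mod_cast hprod
    _ = 4 * (multiplicativeValuationProduct W : ℝ) := by push_cast; ring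
    _ ≤ 4 * (C * N ^ ε) := by gcongr
    _ ≤ 4 * (C * (2 ^ 10 * R) ^ ε) := by gcongr
    _ = 4 * C * ((2 : ℝ) ^ 10) ^ ε * R ^ ε := by
        rw [Real.mul_rpow (by positivity) hR0.le]; ring

/-- Deprecated name of `exponentProductBound_of_manyPrimeFreyClass` (it was stated against the route
decl `Summit.ABC.ABC.Theses.RibetTakahashiSplit.AbcValuationProduct`, dropped from the route file
2026-08-16; it remains in the ledger's `supports` record of stmt-ABC-1561 / stmt-ABC-1567, p88416).
[folklore] -/
@[deprecated exponentProductBound_of_manyPrimeFreyClass (since := "2026-08-16")]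
alias abcValuationProduct_of_manyPrimeFreyClass := exponentProductBound_of_manyPrimeFreyClass

end Summit.ABC.ABC.Theorems

end
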